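import Literature.MathematicalPhysics.QuantumFieldTheory.Federbush1986.PhaseCellIVThmA34Submanifold
import Literature.MathematicalPhysics.QuantumFieldTheory.Federbush1986.PhaseCellIVThmA1Submanifold
import Literature.Analysis.Calculus.ClosedSubgroupSubmanifold
import Literature.LinearAlgebra.Matrix.UnitaryGramSchmidtRetraction
import Literature.NumberTheory.Automorphic.IwasawaDecompositionArchimedean

/-!
# `Federbush1986.PhaseCellIVCompactGroupTargets` — [Federbush1988PhaseCellIV] Appendix A, Theorems A.1–A.4 and §11
# Geometric Constructions 1, 2, 4 for the target `M = G` A COMPACT MATRIX GROUP — in particular HYPOTHESIS-FREE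
# for the gauge groups `U(N)`, `SU(N)` and for the image `ρ(G)` of any compact group under a continuous matrix
# representation

statement-level skeleton of published theorems with citation tags; proofs where landed; nothing here is a claim about
the Yang–Mills mass gap

WHAT IS PRINTED.  Appendix A of [Federbush1988PhaseCellIV] (pp. 339–343) states Theorems A.1–A.4 for «`M` a compact
differentiable manifold (without boundary) … provided with a Riemannian metric» and §11 (Geometric Constructions 1–6,
pp. 337–338) applies them with `M = G`, the (compact Lie) gauge group.  The tree's embedded readings
`ThmA1Emb` / `ThmA2Emb` / `ThmA3ContCap` / `ThmA4ContCap` / `GeomConstruction1,2,4` take `M ⊆ EuclideanSpace ℝ (Fin t)`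
with the ambient metric and are PROVED for every compact embedded `C^∞` submanifold `M` (`thmA1Emb_of_submanifold`,
`geomConstruction1,2_of_submanifold` — r19 p299964; `thmA2Emb_of_submanifold`, `thmA3ContCap_of_submanifold`,
`thmA4ContCap_of_submanifold`, `geomConstruction4_of_submanifold` — p04 p299476), hypothesis-free so far only for
the spheres `S^{t−1} ⊇ {U(1), SU(2)}`.

WHAT THIS FILE PROVES.  By the closed-subgroup theorem in the tree's submanifold vocabulary
(`Literature.Analysis.Calculus.isSubmanifoldOfDim_of_isCompact_subgroup`, [Hall2015] Cor. 3.45, p04 gen 8) every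
COMPACT multiplicative group of matrices `H ⊆ M_N(ℂ)` (`1 ∈ H`, `H · H ⊆ H`, inverses in `H`), read in
`EuclideanSpace ℝ (Fin t)` through ANY real-linear identification `Ψ : M_N(ℂ) ≃L[ℝ] EuclideanSpace ℝ (Fin t)` (such
`Ψ` exist for `t = 2N²`), is a compact embedded `C^∞` submanifold; hence:

* `thmA1Emb_of_isCompact_subgroup`, `thmA2Emb_…`, `thmA3ContCap_…`, `thmA4ContCap_…`, `geomConstruction2_…`,
  `geomConstruction4_…` — Theorems A.1 (every cap), A.2, A.3, A.4 and Constructions 2, 4 for `M = Ψ(H)`;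
  `geomConstruction1_of_isCompact_subgroup` — Construction 1 for connected `H`; bundle `appA_of_isCompact_subgroup`.
* `appA_range_of_compact` — the same for `M = Ψ(ρ(G))`, `G` any compact group, `ρ : G →* M_N(ℂ)` continuous
  (Construction 1 when `G` is connected: `geomConstruction1_range_of_compact`).
* `appA_unitaryGroup'`, `appA_specialUnitaryGroup'` — HYPOTHESIS-FREE instances for the gauge groups `U(N)` and
  `SU(N+1)` (compact: the tree's `Matrix.isCompact_unitaryGroup`; connected: the tree's Gram–Schmidt retraction
  `pathConnectedSpace_unitaryGroup` / `pathConnectedSpace_specialUnitaryGroup`), all seven statements each.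

## References

* P. Federbush, *A phase cell approach to Yang–Mills theory. IV. The choice of variables*, Commun. Math. Phys.
  **114** (1988) 317–343, Appendix A (Theorems A.1–A.4), §11 (Geometric Constructions). [Federbush1988PhaseCellIV]
* B. C. Hall, *Lie Groups, Lie Algebras, and Representations*, 2nd ed. (2015), Cor. 3.45. [Hall2015]
-/

noncomputable section

namespace Literature.MathematicalPhysics.QuantumFieldTheory.Federbush1986

open Metric Set Filter Function
open scoped ContDiff Topology NNReal

namespace PhaseCellIVAppA

open Literature.AlgebraicGeometry.RealAlgebraic Literature.Analysis.Calculus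

variable {N t : ℕ}

/-- Shorthand for this file: complex `N × N` matrices. -/
local notation "𝕄" N => Matrix (Fin N) (Fin N) ℂ

/-! ### Appendix A for a compact matrix group `H ⊆ M_N(ℂ)` -/

section CompactSubgroup

variable {H : Set (𝕄 N)} (hHc : IsCompact H) (h1 : (1 : 𝕄 N) ∈ H) (hmul : ∀ a ∈ H, ∀ b ∈ H, a * b ∈ H)
  (hinv : ∀ a ∈ H, ∃ b ∈ H, b * a = 1)
include hHc h1 hmul hinv

/-- **Theorem A.1 (every cap) for a compact matrix group `M = Ψ(H)`.**
[cite: Federbush1988PhaseCellIV, Theorem A.1 (A.1)–(A.2) p. 339] -/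
theorem thmA1Emb_of_isCompact_subgroup (Ψ : (𝕄 N) ≃L[ℝ] EuclideanSpace ℝ (Fin t)) (n : ℕ) :
    ThmA1Emb n t (Ψ '' H) := by
  obtain ⟨𝔥, -, -, hE⟩ := isSubmanifoldOfDim_of_isCompact_subgroup hHc h1 hmul hinv
  exact thmA1Emb_of_submanifold (hHc.image Ψ.continuous) (hE Ψ) n

/-- **Theorem A.2 (embedded reading) for a compact matrix group `M = Ψ(H)`.**
[cite: Federbush1988PhaseCellIV, Theorem A.2 (A.18)–(A.19) p. 341] -/
theorem thmA2Emb_of_isCompact_subgroup (Ψ : (𝕄 N) ≃L[ℝ] EuclideanSpace ℝ (Fin t)) (n : ℕ) :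
    ThmA2Emb n t (Ψ '' H) := by
  obtain ⟨𝔥, -, -, hE⟩ := isSubmanifoldOfDim_of_isCompact_subgroup hHc h1 hmul hinv
  exact thmA2Emb_of_submanifold (hHc.image Ψ.continuous) (hE Ψ) n

/-- **Theorem A.3 (capped, decl of record `ThmA3ContCap`) for a compact matrix group `M = Ψ(H)`.**
[cite: Federbush1988PhaseCellIV, Theorem A.3 (A.25)–(A.26) p. 342] -/
theorem thmA3ContCap_of_isCompact_subgroup (Ψ : (𝕄 N) ≃L[ℝ] EuclideanSpace ℝ (Fin t)) (n : ℕ) :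
    ThmA3ContCap n t (Ψ '' H) := by
  obtain ⟨𝔥, -, -, hE⟩ := isSubmanifoldOfDim_of_isCompact_subgroup hHc h1 hmul hinv
  exact thmA3ContCap_of_submanifold (hHc.image Ψ.continuous) (hE Ψ) n

/-- **Theorem A.4 (capped, decl of record `ThmA4ContCap`) for a compact matrix group `M = Ψ(H)`.**
[cite: Federbush1988PhaseCellIV, Theorem A.4 (A.34)–(A.36) p. 343] -/
theorem thmA4ContCap_of_isCompact_subgroup (Ψ : (𝕄 N) ≃L[ℝ] EuclideanSpace ℝ (Fin t)) (n : ℕ) :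
    ThmA4ContCap n t (Ψ '' H) := by
  obtain ⟨𝔥, -, -, hE⟩ := isSubmanifoldOfDim_of_isCompact_subgroup hHc h1 hmul hinv
  exact thmA4ContCap_of_submanifold (hHc.image Ψ.continuous) (hE Ψ) n

/-- **Geometric Construction 2 for a compact matrix group `M = Ψ(H)`.**
[cite: Federbush1988PhaseCellIV, Geometric Construction 2 p. 337] -/
theorem geomConstruction2_of_isCompact_subgroup (Ψ : (𝕄 N) ≃L[ℝ] EuclideanSpace ℝ (Fin t)) :
    GeomConstruction2 t (Ψ '' H) := by
  obtain ⟨𝔥, -, -, hE⟩ := isSubmanifoldOfDim_of_isCompact_subgroup hHc h1 hmul hinv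
  exact geomConstruction2_of_submanifold (hHc.image Ψ.continuous) (hE Ψ)

/-- **Geometric Construction 4 for a compact matrix group `M = Ψ(H)`.**
[cite: Federbush1988PhaseCellIV, Geometric Construction 4 p. 338] -/
theorem geomConstruction4_of_isCompact_subgroup (Ψ : (𝕄 N) ≃L[ℝ] EuclideanSpace ℝ (Fin t)) (k : ℕ) :
    GeomConstruction4 k t (Ψ '' H) := by
  obtain ⟨𝔥, -, -, hE⟩ := isSubmanifoldOfDim_of_isCompact_subgroup hHc h1 hmul hinv
  exact geomConstruction4_of_submanifold (hHc.image Ψ.continuous) (hE Ψ) k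

/-- **Geometric Construction 1 for a CONNECTED compact matrix group `M = Ψ(H)`.**
[cite: Federbush1988PhaseCellIV, Geometric Construction 1 (11.4) p. 337] -/
theorem geomConstruction1_of_isCompact_subgroup (hconn : IsPreconnected H)
    (Ψ : (𝕄 N) ≃L[ℝ] EuclideanSpace ℝ (Fin t)) : GeomConstruction1 t (Ψ '' H) := by
  obtain ⟨𝔥, -, -, hE⟩ := isSubmanifoldOfDim_of_isCompact_subgroup hHc h1 hmul hinv
  exact geomConstruction1_of_submanifold (hHc.image Ψ.continuous) (hconn.image _ Ψ.continuous.continuousOn)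
    (hE Ψ)

/-- **Appendix A for a compact matrix group**: Theorems A.1–A.4 and Geometric Constructions 2, 4 hold for the
target `Ψ(H) ⊆ EuclideanSpace ℝ (Fin t)` for every compact multiplicative group of matrices `H ⊆ M_N(ℂ)`, every
cube/ball dimension and every real-linear identification `Ψ` (Construction 1 in addition when `H` is connected,
`geomConstruction1_of_isCompact_subgroup`).
[cite: Federbush1988PhaseCellIV, Appendix A Theorems A.1–A.4 pp. 339–343; §11 pp. 337–338] -/
theorem appA_of_isCompact_subgroup (Ψ : (𝕄 N) ≃L[ℝ] EuclideanSpace ℝ (Fin t)) (n : ℕ) :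
    ThmA1Emb n t (Ψ '' H) ∧ ThmA2Emb n t (Ψ '' H) ∧ ThmA3ContCap n t (Ψ '' H) ∧ ThmA4ContCap n t (Ψ '' H) ∧
      GeomConstruction2 t (Ψ '' H) ∧ GeomConstruction4 n t (Ψ '' H) :=
  ⟨thmA1Emb_of_isCompact_subgroup hHc h1 hmul hinv Ψ n, thmA2Emb_of_isCompact_subgroup hHc h1 hmul hinv Ψ n,
    thmA3ContCap_of_isCompact_subgroup hHc h1 hmul hinv Ψ n, thmA4ContCap_of_isCompact_subgroup hHc h1 hmul hinv Ψ n,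
    geomConstruction2_of_isCompact_subgroup hHc h1 hmul hinv Ψ,
    geomConstruction4_of_isCompact_subgroup hHc h1 hmul hinv Ψ n⟩

end CompactSubgroup

/-! ### Appendix A for the image `ρ(G)` of a compact group under a continuous matrix representation -/

section Representation

variable {G : Type*} [Group G] [TopologicalSpace G] [CompactSpace G]

omit t in
/-- `ρ(G)` is a compact multiplicative group of matrices. [cite: Hall2015, §3.8 Cor. 3.45] -/
theorem range_hyps (ρ : G →* 𝕄 N) (hρ : Continuous ρ) :
    IsCompact (Set.range ρ) ∧ (1 : 𝕄 N) ∈ Set.range ρ ∧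
      (∀ a ∈ Set.range ρ, ∀ b ∈ Set.range ρ, a * b ∈ Set.range ρ) ∧
      (∀ a ∈ Set.range ρ, ∃ b ∈ Set.range ρ, b * a = 1) := by
  refine ⟨isCompact_range hρ, ⟨1, map_one ρ⟩, ?_, ?_⟩
  · rintro _ ⟨a, rfl⟩ _ ⟨b, rfl⟩
    exact ⟨a * b, map_mul ρ a b⟩
  · rintro _ ⟨a, rfl⟩
    exact ⟨ρ a⁻¹, ⟨a⁻¹, rfl⟩, by rw [← map_mul, inv_mul_cancel, map_one]⟩

/-- **Appendix A for `M = Ψ(ρ(G))`**, `G` any compact group, `ρ` any continuous matrix representation: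
Theorems A.1–A.4 and Geometric Constructions 2, 4.
[cite: Federbush1988PhaseCellIV, Appendix A Theorems A.1–A.4 pp. 339–343; §11 pp. 337–338] -/
theorem appA_range_of_compact (ρ : G →* 𝕄 N) (hρ : Continuous ρ) (Ψ : (𝕄 N) ≃L[ℝ] EuclideanSpace ℝ (Fin t))
    (n : ℕ) :
    ThmA1Emb n t (Ψ '' Set.range ρ) ∧ ThmA2Emb n t (Ψ '' Set.range ρ) ∧ ThmA3ContCap n t (Ψ '' Set.range ρ) ∧
      ThmA4ContCap n t (Ψ '' Set.range ρ) ∧ GeomConstruction2 t (Ψ '' Set.range ρ) ∧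
      GeomConstruction4 n t (Ψ '' Set.range ρ) := by
  obtain ⟨hc, h1, hmul, hinv⟩ := range_hyps ρ hρ
  exact appA_of_isCompact_subgroup hc h1 hmul hinv Ψ n

/-- **Geometric Construction 1 for `M = Ψ(ρ(G))`** when `G` is connected.
[cite: Federbush1988PhaseCellIV, Geometric Construction 1 (11.4) p. 337] -/
theorem geomConstruction1_range_of_compact [ConnectedSpace G] (ρ : G →* 𝕄 N) (hρ : Continuous ρ)
    (Ψ : (𝕄 N) ≃L[ℝ] EuclideanSpace ℝ (Fin t)) : GeomConstruction1 t (Ψ '' Set.range ρ) := by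
  obtain ⟨hc, h1, hmul, hinv⟩ := range_hyps ρ hρ
  exact geomConstruction1_of_isCompact_subgroup hc h1 hmul hinv (isPreconnected_range hρ) Ψ

end Representation

/-! ### The gauge groups `U(N)` and `SU(N)`: all seven statements, hypothesis-free -/

omit t in
/-- `U(N) ⊆ M_N(ℂ)` is a compact multiplicative group of matrices (compactness: the tree's
`Matrix.isCompact_unitaryGroup`). [cite: Hall2015, §3.8 Cor. 3.45] -/
theorem unitaryGroup_hyps (N : ℕ) :
    IsCompact (Matrix.unitaryGroup (Fin N) ℂ : Set (𝕄 N)) ∧ (1 : 𝕄 N) ∈ (Matrix.unitaryGroup (Fin N) ℂ : Set (𝕄 N)) ∧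
      (∀ a ∈ (Matrix.unitaryGroup (Fin N) ℂ : Set (𝕄 N)), ∀ b ∈ (Matrix.unitaryGroup (Fin N) ℂ : Set (𝕄 N)),
        a * b ∈ (Matrix.unitaryGroup (Fin N) ℂ : Set (𝕄 N))) ∧
      (∀ a ∈ (Matrix.unitaryGroup (Fin N) ℂ : Set (𝕄 N)), ∃ b ∈ (Matrix.unitaryGroup (Fin N) ℂ : Set (𝕄 N)),
        b * a = 1) := by
  refine ⟨Literature.NumberTheory.Automorphic.Matrix.isCompact_unitaryGroup, Submonoid.one_mem _,
    fun a ha b hb => Submonoid.mul_mem _ ha hb, fun a ha => ?_⟩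
  exact ⟨star a, Unitary.star_mem ha, Matrix.mem_unitaryGroup_iff'.mp ha⟩

omit t in
/-- `SU(N) ⊆ M_N(ℂ)` is a compact multiplicative group of matrices (`SU(N) = U(N) ∩ {det = 1}` is closed in the
compact `U(N)`). [cite: Hall2015, §3.8 Cor. 3.45] -/
theorem specialUnitaryGroup_hyps (N : ℕ) :
    IsCompact (Matrix.specialUnitaryGroup (Fin N) ℂ : Set (𝕄 N)) ∧
      (1 : 𝕄 N) ∈ (Matrix.specialUnitaryGroup (Fin N) ℂ : Set (𝕄 N)) ∧
      (∀ a ∈ (Matrix.specialUnitaryGroup (Fin N) ℂ : Set (𝕄 N)),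
        ∀ b ∈ (Matrix.specialUnitaryGroup (Fin N) ℂ : Set (𝕄 N)), a * b ∈ (Matrix.specialUnitaryGroup (Fin N) ℂ : Set (𝕄 N))) ∧
      (∀ a ∈ (Matrix.specialUnitaryGroup (Fin N) ℂ : Set (𝕄 N)),
        ∃ b ∈ (Matrix.specialUnitaryGroup (Fin N) ℂ : Set (𝕄 N)), b * a = 1) := by
  have hU : IsCompact (Matrix.unitaryGroup (Fin N) ℂ : Set (𝕄 N)) :=
    Literature.NumberTheory.Automorphic.Matrix.isCompact_unitaryGroup
  have hdet : IsClosed {A : 𝕄 N | A.det = 1} := isClosed_eq (continuous_id.matrix_det) continuous_const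
  have hset : (Matrix.specialUnitaryGroup (Fin N) ℂ : Set (𝕄 N)) =
      (Matrix.unitaryGroup (Fin N) ℂ : Set (𝕄 N)) ∩ {A | A.det = 1} := by
    ext A
    simp [Matrix.mem_specialUnitaryGroup_iff]
  refine ⟨by rw [hset]; exact hU.inter_right hdet, Submonoid.one_mem _, fun a ha b hb => Submonoid.mul_mem _ ha hb,
    fun a ha => ?_⟩
  rw [SetLike.mem_coe, Matrix.mem_specialUnitaryGroup_iff] at ha
  refine ⟨star a, ?_, Matrix.mem_unitaryGroup_iff'.mp ha.1⟩
  rw [SetLike.mem_coe, Matrix.mem_specialUnitaryGroup_iff]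
  exact ⟨Unitary.star_mem ha.1, by rw [Matrix.star_eq_conjTranspose, Matrix.det_conjTranspose, ha.2, star_one]⟩

omit t in
/-- `U(N)` is connected (the tree's Gram–Schmidt retraction: `U(N)` is path connected). [cite: HatcherAT2002, §3.D] -/
theorem isPreconnected_unitaryGroup (N : ℕ) : IsPreconnected (Matrix.unitaryGroup (Fin N) ℂ : Set (𝕄 N)) := by
  have h : IsPathConnected (Matrix.unitaryGroup (Fin N) ℂ : Set (𝕄 N)) := by
    simpa using isPathConnected_range
      (continuous_subtype_val (p := fun A : 𝕄 N => A ∈ Matrix.unitaryGroup (Fin N) ℂ))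
  exact h.isConnected.isPreconnected

omit t in
/-- `SU(N+1)` is connected. [cite: HatcherAT2002, §3.D] -/
theorem isPreconnected_specialUnitaryGroup (N : ℕ) :
    IsPreconnected (Matrix.specialUnitaryGroup (Fin (N + 1)) ℂ : Set (𝕄 (N + 1))) := by
  have h : IsPathConnected (Matrix.specialUnitaryGroup (Fin (N + 1)) ℂ : Set (𝕄 (N + 1))) := by
    simpa using isPathConnected_range
      (continuous_subtype_val (p := fun A : 𝕄 (N + 1) => A ∈ Matrix.specialUnitaryGroup (Fin (N + 1)) ℂ))
  exact h.isConnected.isPreconnected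

/-- **Appendix A for the gauge group `U(N)`, hypothesis-free**: Theorems A.1 (every cap), A.2, A.3, A.4 and
Geometric Constructions 1, 2, 4 for the target `Ψ(U(N)) ⊆ EuclideanSpace ℝ (Fin t)`, every `N`, every cube/ball
dimension `n`, every real-linear identification `Ψ : M_N(ℂ) ≃L[ℝ] EuclideanSpace ℝ (Fin t)`.
[cite: Federbush1988PhaseCellIV, Appendix A Theorems A.1–A.4 pp. 339–343; §11 pp. 337–338] -/
theorem appA_unitaryGroup' (Ψ : (𝕄 N) ≃L[ℝ] EuclideanSpace ℝ (Fin t)) (n : ℕ) :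
    ThmA1Emb n t (Ψ '' (Matrix.unitaryGroup (Fin N) ℂ : Set (𝕄 N))) ∧
      ThmA2Emb n t (Ψ '' (Matrix.unitaryGroup (Fin N) ℂ : Set (𝕄 N))) ∧
      ThmA3ContCap n t (Ψ '' (Matrix.unitaryGroup (Fin N) ℂ : Set (𝕄 N))) ∧
      ThmA4ContCap n t (Ψ '' (Matrix.unitaryGroup (Fin N) ℂ : Set (𝕄 N))) ∧
      GeomConstruction1 t (Ψ '' (Matrix.unitaryGroup (Fin N) ℂ : Set (𝕄 N))) ∧
      GeomConstruction2 t (Ψ '' (Matrix.unitaryGroup (Fin N) ℂ : Set (𝕄 N))) ∧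
      GeomConstruction4 n t (Ψ '' (Matrix.unitaryGroup (Fin N) ℂ : Set (𝕄 N))) := by
  obtain ⟨hc, h1, hmul, hinv⟩ := unitaryGroup_hyps N
  obtain ⟨hA1, hA2, hA3, hA4, hG2, hG4⟩ := appA_of_isCompact_subgroup hc h1 hmul hinv Ψ n
  exact ⟨hA1, hA2, hA3, hA4, geomConstruction1_of_isCompact_subgroup hc h1 hmul hinv (isPreconnected_unitaryGroup N) Ψ,
    hG2, hG4⟩

/-- **Appendix A for the gauge group `SU(N+1)`, hypothesis-free**: Theorems A.1 (every cap), A.2, A.3, A.4 and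
Geometric Constructions 1, 2, 4 for the target `Ψ(SU(N+1)) ⊆ EuclideanSpace ℝ (Fin t)`.
[cite: Federbush1988PhaseCellIV, Appendix A Theorems A.1–A.4 pp. 339–343; §11 pp. 337–338] -/
theorem appA_specialUnitaryGroup' (Ψ : (𝕄 (N + 1)) ≃L[ℝ] EuclideanSpace ℝ (Fin t)) (n : ℕ) :
    ThmA1Emb n t (Ψ '' (Matrix.specialUnitaryGroup (Fin (N + 1)) ℂ : Set (𝕄 (N + 1)))) ∧
      ThmA2Emb n t (Ψ '' (Matrix.specialUnitaryGroup (Fin (N + 1)) ℂ : Set (𝕄 (N + 1)))) ∧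
      ThmA3ContCap n t (Ψ '' (Matrix.specialUnitaryGroup (Fin (N + 1)) ℂ : Set (𝕄 (N + 1)))) ∧
      ThmA4ContCap n t (Ψ '' (Matrix.specialUnitaryGroup (Fin (N + 1)) ℂ : Set (𝕄 (N + 1)))) ∧
      GeomConstruction1 t (Ψ '' (Matrix.specialUnitaryGroup (Fin (N + 1)) ℂ : Set (𝕄 (N + 1)))) ∧
      GeomConstruction2 t (Ψ '' (Matrix.specialUnitaryGroup (Fin (N + 1)) ℂ : Set (𝕄 (N + 1)))) ∧
      GeomConstruction4 n t (Ψ '' (Matrix.specialUnitaryGroup (Fin (N + 1)) ℂ : Set (𝕄 (N + 1)))) := by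
  obtain ⟨hc, h1, hmul, hinv⟩ := specialUnitaryGroup_hyps (N + 1)
  obtain ⟨hA1, hA2, hA3, hA4, hG2, hG4⟩ := appA_of_isCompact_subgroup hc h1 hmul hinv Ψ n
  exact ⟨hA1, hA2, hA3, hA4,
    geomConstruction1_of_isCompact_subgroup hc h1 hmul hinv (isPreconnected_specialUnitaryGroup N) Ψ, hG2, hG4⟩

/-- **The decls of record of rows F4.ThmA.3 / F4.ThmA.4 for `SU(N+1)` and `U(N)`, stated separately** (for the
fold): `ThmA3ContCap` and `ThmA4ContCap` hold for the targets `Ψ(U(N))`, `Ψ(SU(N+1))`.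
[cite: Federbush1988PhaseCellIV, Theorem A.3 p. 342; Theorem A.4 p. 343] -/
theorem thmA3ContCap_and_thmA4ContCap_gaugeGroups (Ψ : (𝕄 (N + 1)) ≃L[ℝ] EuclideanSpace ℝ (Fin t)) (n : ℕ) :
    (ThmA3ContCap n t (Ψ '' (Matrix.unitaryGroup (Fin (N + 1)) ℂ : Set (𝕄 (N + 1)))) ∧
      ThmA4ContCap n t (Ψ '' (Matrix.unitaryGroup (Fin (N + 1)) ℂ : Set (𝕄 (N + 1))))) ∧
      (ThmA3ContCap n t (Ψ '' (Matrix.specialUnitaryGroup (Fin (N + 1)) ℂ : Set (𝕄 (N + 1)))) ∧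
        ThmA4ContCap n t (Ψ '' (Matrix.specialUnitaryGroup (Fin (N + 1)) ℂ : Set (𝕄 (N + 1))))) := by
  obtain ⟨-, -, hA3, hA4, -⟩ := appA_unitaryGroup' (N := N + 1) Ψ n
  obtain ⟨-, -, hB3, hB4, -⟩ := appA_specialUnitaryGroup' (N := N) Ψ n
  exact ⟨⟨hA3, hA4⟩, hB3, hB4⟩

end PhaseCellIVAppA

end Literature.MathematicalPhysics.QuantumFieldTheory.Federbush1986
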